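import Summits.FinalStateConjecture.FinalStateConjecture.Theorems.PhotonSphereChannelsWindowedShellChannelsGlueToolkit
import Summits.FinalStateConjecture.FinalStateConjecture.Theorems.PhotonSphereChannelsWindowedShellChannelsGluePotential

/-!
# Crux `WindowedShellChannels` (stmt-FinalStateConjecture-14085), line `Sketch` — glue toolkit, part 3
# (the near and far shares in one-sided form, and the two numerical lemmas of the composition)

* `nearShare_reflect` — the landed two-ended near shoulder estimate (`stub_nearShoulder`, ρ = 9, aperture
  `1/3 + 2 log(3/2) > 0`) for a parity-pure solution with data in `(−∞, −9)`, rewritten as a FAR channel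
  bound for the spatial reflection: `E/4 ≤ farChannelEnergy V♭ (−H) n♭ atTop` for every `H ≥ 0`;
* `farShare_of_twoSided` — a two-sided apex-0 far bound `E/64 ≤ far⁺ + far⁻` plus a time parity give
  `E/128 ≤ farChannelEnergy V (−H) f atTop`;
* `near_late_small` — `8K²(R+H+2)³e^{(H−T)/2} ≤ ε` in the regime of the composition
  (`K = (ℓ+1)²`, `R = 2L`, `T = 4L − 1`, `L ≥ H + 2`, `L ≥ 2·10¹⁰/ε`, `L ≥ (ℓ+1)⁴`);
* `kappa_ge` — the final constant of `glue_core` is at least `c₁/4` for `η = c₁/16`, `ε = c₁²/1024`,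
  `δ ≤ c₁²/32`.

No definitions. [folklore]
-/

noncomputable section

set_option linter.dupNamespace false

open Set Filter Topology Function MeasureTheory
open scoped ENNReal

namespace Summit.FinalStateConjecture.FinalStateConjecture.Theorems.WindowedShellChannelsSketch

open Literature.Geometry.Lorentzian Literature.Geometry.Lorentzian.ReggeWheeler
open Summit.FinalStateConjecture.FinalStateConjecture.Theorems
open Summit.FinalStateConjecture.FinalStateConjecture.Theorems.CauchyWaveGlobal
open Summit.FinalStateConjecture.FinalStateConjecture.Theorems.WindowedShellChannelsSplit
open Summit.FinalStateConjecture.FinalStateConjecture.Theorems.WindowedShellChannelsStubs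

namespace Glue

variable {V : ℝ → ℝ} {ψ : ℝ → ℝ → ℝ} {σ : ℝ}

/-- A solution with data in `(−∞, B)` has NO far energy beyond any edge `a ≥ B`. [folklore] -/
theorem farEnergy_eq_zero_of_near (hV : Differentiable ℝ V) (hV0 : ∀ x, 0 ≤ V x) (hψ : IsSolution V ψ)
    {B a : ℝ} (hsupp : CauchyDataSupportedOn ψ (Iio B)) (hBa : B ≤ a) (t : ℝ) :
    farEnergy V a ψ t = 0 := by
  unfold farEnergy
  have h : ∀ x ∈ {x : ℝ | a + |t| < x}, ENNReal.ofReal (energyDensity V ψ t x) = 0 := by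
    intro x hx
    have hx' : B + |t| < x := lt_of_le_of_lt (by linarith) hx
    obtain ⟨h0, h1, h2⟩ := firstOrder_vanish_near hV hV0 hψ hsupp hx'
    rw [energyDensity_eq_zero_of_vanish h0 h1 h2, ENNReal.ofReal_zero]
  change ∫⁻ x in Ioi (a + |t|), ENNReal.ofReal (energyDensity V ψ t x) = 0
  rw [setLIntegral_congr_fun measurableSet_Ioi h, lintegral_zero]

/-- For a solution with data in `(−∞, B)`, `B ≤ a`, `0 ≤ a`, the two-sided channel energy of aperture `a`
about `0` is the far channel energy of the reflection. [folklore] -/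
theorem channelEnergy_eq_far_reflect_of_near (hV : Differentiable ℝ V) (hV0 : ∀ x, 0 ≤ V x)
    (hψ : IsSolution V ψ) {B a : ℝ} (hsupp : CauchyDataSupportedOn ψ (Iio B)) (hBa : B ≤ a)
    (ha : 0 ≤ a) :
    channelEnergy V 0 a ψ atTop = farChannelEnergy (fun x => V (-x)) a (fun t x => ψ t (-x)) atTop := by
  unfold channelEnergy farChannelEnergy
  refine liminf_congr (Eventually.of_forall fun t => ?_)
  have hat : 0 ≤ a + |t| := by positivity
  rw [exteriorEnergy_eq_far_add_reflect hψ hat, farEnergy_eq_zero_of_near hV hV0 hψ hsupp hBa t,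
    zero_add]

/-- **Near share, reflected.**  A parity-`σ` unit-mass centred Regge–Wheeler solution of a mode `s ≤ 2`,
`s ≤ ℓ`, with Cauchy data in `(−∞, −9)` radiates a quarter of its energy into the reflected far window
of any edge `−H ≤ 0`: `E/4 ≤ farChannelEnergy V♭ (−H) n♭ atTop` (from `stub_nearShoulder`). [folklore] -/
theorem nearShare_reflect {s ℓ : ℕ} (hs : s ≤ 2) (hsℓ : s ≤ ℓ) {n : ℝ → ℝ → ℝ}
    (hn : IsRWSolution 1 s ℓ (tortoiseRadius one_pos 0) n) (hpar : ∀ t x, n (-t) x = σ * n t x)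
    (hsupp : CauchyDataSupportedOn n (Iio (-9))) {H : ℝ} (hH : 0 ≤ H) :
    ENNReal.ofReal (1 / 4) * totalEnergy (linePotential 1 s ℓ (tortoiseRadius one_pos 0)) n 0
      ≤ farChannelEnergy (fun x => linePotential 1 s ℓ (tortoiseRadius one_pos 0) (-x)) (-H)
          (fun t x => n t (-x)) atTop := by
  have hr := isTortoiseRadius_tortoiseRadius one_pos (0 : ℝ)
  set V : ℝ → ℝ := linePotential 1 s ℓ (tortoiseRadius one_pos 0) with hV
  have hVd : Differentiable ℝ V := RW.differentiable_linePotential hr s ℓ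
  have hV0 : ∀ x, 0 ≤ V x := fun x => (RW.linePotential_pos hr hsℓ x).le
  set a : ℝ := 1 / 3 + 2 * 1 * Real.log (3 / 2) with ha
  have hlog : 0 < Real.log (3 / 2) := Real.log_pos (by norm_num)
  have ha0 : 0 ≤ a := by rw [ha]; positivity
  have hsupp' : CauchyDataSupportedOn n (Iio (0 - 9 * 1)) := by
    rw [zero_sub, mul_one]; exact hsupp
  have key := WindowedShellChannelsNear.stub_nearShoulder 1 one_pos (9 * 1) le_rfl
    (tortoiseRadius one_pos 0) 0 hr s ℓ hs hsℓ n hn hsupp'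
  rw [NearHalfShare.channelEnergy_atBot_eq_atTop' hpar] at key
  have hhalf := NearHalfShare.half_of_two_sided key
  rw [show (1 / 2 / 2 : ℝ) = 1 / 4 by norm_num] at hhalf
  have h9a : (-9 : ℝ) ≤ a := by linarith
  rw [show (1 : ℝ) / 3 + 2 * 1 * Real.log (3 / 2) = a from rfl,
    channelEnergy_eq_far_reflect_of_near hVd hV0 hn hsupp h9a ha0] at hhalf
  exact hhalf.trans (farChannelEnergy_mono_edge (by linarith) atTop)

/-- **Far share, one-sided.**  A two-sided apex-`0` far bound `E/64 ≤ far⁺ + far⁻` for a parity-pure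
solution gives `E/128 ≤ farChannelEnergy V (−H) f atTop` for every `H ≥ 0`. [folklore] -/
theorem farShare_of_twoSided {f : ℝ → ℝ → ℝ} (hpar : ∀ t x, f (-t) x = σ * f t x)
    (h2 : ENNReal.ofReal (1 / 64) * totalEnergy V f 0
      ≤ farChannelEnergy V 0 f atTop + farChannelEnergy V 0 f atBot) {H : ℝ} (hH : 0 ≤ H) :
    ENNReal.ofReal (1 / 128) * totalEnergy V f 0 ≤ farChannelEnergy V (-H) f atTop := by
  rw [farChannelEnergy_atBot_eq_atTop' hpar] at h2
  have hhalf := NearHalfShare.half_of_two_sided h2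
  rw [show (1 / 64 / 2 : ℝ) = 1 / 128 by norm_num] at hhalf
  exact hhalf.trans (farChannelEnergy_mono_edge (by linarith) atTop)

/-- `x⁹ ≤ 2¹²·(4!)³·e^{3x/2}` for `x ≥ 0`, i.e. `x³e^{−3x/2} ≤ 2¹²·13824/x⁶`… in the form used below:
`L³ · e^{−3L/2} · L⁶ ≤ 2¹² · 13824` is replaced by the cleaner `L⁴ ≤ 24·16·e^{L/2}`. [folklore] -/
theorem pow_four_le_exp_half {L : ℝ} (hL : 0 ≤ L) : L ^ 4 ≤ 384 * Real.exp (L / 2) := by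
  have h := Real.pow_div_factorial_le_exp (L / 2) (n := 4) (by positivity)
  have h4 : (Nat.factorial 4 : ℝ) = 24 := by norm_num [Nat.factorial]
  rw [h4, div_le_iff₀ (by norm_num)] at h
  have : (L / 2) ^ 4 = L ^ 4 / 16 := by ring
  rw [this] at h
  linarith

/-- **The near late drop is small in the regime of the composition**: with `K = (ℓ+1)²`, `R = 2L`,
`T = 4L − 1`, `L ≥ H + 2`, `H ≥ 0`, `L ≥ (ℓ+1)⁴`, `L ≥ 2·10¹⁰/ε`, `0 < ε`:
`8K²(R+H+2)³e^{(H−T)/2} ≤ ε`. [folklore] -/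
theorem near_late_small {ℓ : ℕ} {L H ε : ℝ} (hH : 0 ≤ H) (hε : 0 < ε) (hLH : H + 2 ≤ L)
    (hLℓ : ((ℓ : ℝ) + 1) ^ 4 ≤ L) (hLε : 2 * 10 ^ 10 / ε ≤ L) :
    8 * (((ℓ : ℝ) + 1) ^ 2) ^ 2 * (2 * L + H + 2) ^ 3 * Real.exp ((H - (4 * L - 1)) / 2) ≤ ε := by
  have hL0 : 0 < L := by linarith
  have hL1 : 1 ≤ L := by linarith
  -- `(ℓ+1)⁴ ≤ L`, `2L + H + 2 ≤ 3L`, `e^{(H − 4L + 1)/2} ≤ e^{−3L/2}`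
  have h1 : (((ℓ : ℝ) + 1) ^ 2) ^ 2 ≤ L := by rw [← pow_mul]; exact hLℓ
  have h2 : (2 * L + H + 2) ^ 3 ≤ (3 * L) ^ 3 := by
    apply pow_le_pow_left₀ (by positivity); linarith
  have h3 : Real.exp ((H - (4 * L - 1)) / 2) ≤ Real.exp (-(3 * L / 2)) :=
    Real.exp_le_exp.2 (by linarith)
  -- `e^{3L/2} = (e^{L/2})³ ≥ (L⁴/384)³`
  have h4 : L ^ 4 ≤ 384 * Real.exp (L / 2) := pow_four_le_exp_half hL0.le
  have hE : 0 < Real.exp (L / 2) := Real.exp_pos _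
  have h5 : Real.exp (-(3 * L / 2)) = (Real.exp (L / 2))⁻¹ ^ 3 := by
    rw [← Real.exp_neg, ← Real.exp_nat_mul]; congr 1; ring
  have h6 : (Real.exp (L / 2))⁻¹ ≤ 384 / L ^ 4 := by
    rw [inv_le_comm₀ hE (by positivity), inv_div]
    rw [div_le_iff₀ (by norm_num)]; linarith
  have h7 : Real.exp (-(3 * L / 2)) ≤ (384 / L ^ 4) ^ 3 := by
    rw [h5]; exact pow_le_pow_left₀ (by positivity) h6 3
  -- assemble: `8 L (3L)³ (384/L⁴)³ = 8·27·384³ / L⁸ ≤ ε` since `L⁸ ≥ L·L ≥ (2·10¹⁰/ε)·1`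
  have hmain : 8 * (((ℓ : ℝ) + 1) ^ 2) ^ 2 * (2 * L + H + 2) ^ 3 * Real.exp ((H - (4 * L - 1)) / 2)
      ≤ 8 * L * (3 * L) ^ 3 * (384 / L ^ 4) ^ 3 := by
    have e0 : 0 ≤ Real.exp ((H - (4 * L - 1)) / 2) := (Real.exp_pos _).le
    calc 8 * (((ℓ : ℝ) + 1) ^ 2) ^ 2 * (2 * L + H + 2) ^ 3 * Real.exp ((H - (4 * L - 1)) / 2)
        ≤ 8 * L * (3 * L) ^ 3 * Real.exp ((H - (4 * L - 1)) / 2) := by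
          apply mul_le_mul_of_nonneg_right _ e0
          exact mul_le_mul (mul_le_mul_of_nonneg_left h1 (by norm_num)) h2 (by positivity)
            (by positivity)
      _ ≤ 8 * L * (3 * L) ^ 3 * (384 / L ^ 4) ^ 3 :=
          mul_le_mul_of_nonneg_left (h3.trans h7) (by positivity)
  have hval : 8 * L * (3 * L) ^ 3 * (384 / L ^ 4) ^ 3 = 8 * 27 * 384 ^ 3 / L ^ 8 := by
    field_simp
    ring
  rw [hval] at hmain
  have hL8 : 2 * 10 ^ 10 / ε ≤ L ^ 8 := by
    calc 2 * 10 ^ 10 / ε ≤ L := hLε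
      _ ≤ L ^ 8 := le_self_pow₀ hL1 (by norm_num)
  have hfin : 8 * 27 * 384 ^ 3 / L ^ 8 ≤ ε := by
    rw [div_le_iff₀ (by positivity)]
    have : (2 * 10 ^ 10 / ε) * ε ≤ L ^ 8 * ε := mul_le_mul_of_nonneg_right hL8 hε.le
    rw [div_mul_cancel₀ _ hε.ne'] at this
    nlinarith
  exact hmain.trans hfin

/-- **The final constant of the composition**: for `0 < c₁ ≤ 1`, `η = c₁/16`, `ε = c₁²/1024` and
`0 ≤ δ ≤ c₁²/32`,
`c₁/4 ≤ 1 − (1+η)((1 − c₁) + η + 2ε/η)(1+δ) − (1+η⁻¹)δ`. [folklore] -/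
theorem kappa_ge {c₁ δ : ℝ} (hc : 0 < c₁) (hc1 : c₁ ≤ 1) (hδ : 0 ≤ δ) (hδ1 : δ ≤ c₁ ^ 2 / 32) :
    c₁ / 4 ≤ 1 - (1 + c₁ / 16) * ((1 - c₁) + c₁ / 16 + 2 * (c₁ ^ 2 / 1024) / (c₁ / 16)) * (1 + δ)
      - (1 + (c₁ / 16)⁻¹) * δ := by
  have e1 : 2 * (c₁ ^ 2 / 1024) / (c₁ / 16) = c₁ / 32 := by
    field_simp; norm_num
  have e2 : (1 + (c₁ / 16)⁻¹) * δ = δ + 16 * δ / c₁ := by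
    field_simp
  rw [e1, e2]
  -- `(1+η)(1 − 29c₁/32) ≤ 1 − 27c₁/32`, times `(1+δ)`; and `16δ/c₁ ≤ c₁/2`, `δ ≤ 1/32`
  have h1 : (1 + c₁ / 16) * ((1 - c₁) + c₁ / 16 + c₁ / 32) ≤ 1 - 27 * c₁ / 32 := by nlinarith
  have h0 : 0 ≤ (1 + c₁ / 16) * ((1 - c₁) + c₁ / 16 + c₁ / 32) := by
    apply mul_nonneg (by positivity); nlinarith
  have h2 : (1 + c₁ / 16) * ((1 - c₁) + c₁ / 16 + c₁ / 32) * (1 + δ) ≤ (1 - 27 * c₁ / 32) * (1 + δ) :=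
    mul_le_mul_of_nonneg_right h1 (by positivity)
  have h3 : 16 * δ / c₁ ≤ c₁ / 2 := by
    rw [div_le_iff₀ hc]; nlinarith
  have h4 : δ ≤ 1 / 32 := hδ1.trans (by nlinarith)
  nlinarith

end Glue

/-- **Registered principal statement of this file** (`glueShares_far`): a two-sided apex-`0` far bound
`E/64 ≤ far⁺ + far⁻` for a parity-pure solution gives the one-sided bound `E/128 ≤ farChannelEnergy V (−H) f atTop`
for every `H ≥ 0`. [folklore] -/
theorem glueShares_far : ∀ (V : ℝ → ℝ) (f : ℝ → ℝ → ℝ) (σ : ℝ), (∀ t x, f (-t) x = σ * f t x) →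
    ENNReal.ofReal (1 / 64) * totalEnergy V f 0 ≤ farChannelEnergy V 0 f atTop + farChannelEnergy V 0 f atBot →
    ∀ H : ℝ, 0 ≤ H → ENNReal.ofReal (1 / 128) * totalEnergy V f 0 ≤ farChannelEnergy V (-H) f atTop :=
  fun _ _ _ hpar h2 _ hH => Glue.farShare_of_twoSided hpar h2 hH

end Summit.FinalStateConjecture.FinalStateConjecture.Theorems.WindowedShellChannelsSketch

end
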